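import Mathlib.GroupTheory.SpecificGroups.Dihedral
import Mathlib.GroupTheory.SpecificGroups.Quaternion
import Mathlib.Tactic.Linarith
import Mathlib.Tactic.Abel
import Mathlib.Tactic.Group
import Literature.Combinatorics.Additive.TripleProductProperty
import Summits.MatrixMultiplication.OmegaCensus.DihedralTPPUpperBound
import HarnessLib

/-!
# `3·|S||T||U| ≤ 4|G|` for every group with a dihedral-like presentation (generalized dihedral / dicyclic)

ω-census, family (b3).  Framing: lottery ticket; floor = certified bounds/negative ranges.

Let `A` be a finite abelian group (additive) and `G` a group whose elements are `ρ a` ("rotations") and `τ a`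
("reflections"), `a ∈ A`, bijectively, with the multiplication table
`ρ a ρ b = ρ(a+b)`, `ρ a τ b = τ(b−a)`, `τ a ρ b = τ(a+b)`, `τ a τ b = ρ(c₀ + b − a)` for a fixed `c₀ ∈ A`.
These are exactly the finite groups with an abelian subgroup `ρ(A)` of index `2` on which every element outside acts
by inversion: generalized dihedral groups `Dih(A)` (`c₀ = 0`; `D_{2n}` for `A = ZMod n`) and generalized dicyclic
groups (`2c₀ = 0 ≠ c₀`; the dicyclic / generalized quaternion groups `Q_{4n} = QuaternionGroup n` for `A = ZMod 2n`,
`c₀ = n`).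

**Theorem (`tpp_volume_le_of_dihedralLike`).** Every TPP triple `(S,T,U)` of such a `G` has `3|S||T||U| ≤ 8|A| = 4|G|`.
Instances: `tpp_volume_le_quaternion` (`Q_{4n}`: `3|S||T||U| ≤ 16 n`), and `DihedralTPPUpperBound.lean` (`D_{2n}`,
proved there directly).  This covers 8 of the 12 non-dihedral groups on which the census tested its Conjecture′
(`β(G) ≤ 4⌊|G|/3⌋` for index-2-abelian `G`: Dih(ℤ₃²), ℤ₂×D₈, Q₁₆, Dic₂₀, Dic₂₄, Dih(ℤ₂×ℤ₆), Dih(ℤ₄²), Dih(ℤ₃×ℤ₆));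
for the remaining ones (M₁₆, SD₁₆, ℤ₁₆⋊₇ℤ₂, M₃₂: the involution is not inversion) the untwisted coset sumsets need
not be injective and this argument does not apply (checked numerically, seat notes).

**Proof.** Identical to the dihedral case: coset coordinates `X = ρ(X₀) ⊔ τ(X₁)`, the TPP relation read on coset
patterns gives 8 injective sumsets `X_i + Y_j + Z_k ⊆ A` and two pairwise-disjoint triangles
(`{100,010,001}`, `{011,101,110}`) — the constant `c₀` cancels in every relation used — hence the four counting
constraints and `core_nat` (`DihedralTPPUpperBound.lean`).
-/

namespace Summit.MatrixMultiplication.OmegaCensus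

open Literature.Combinatorics.Additive Finset

section DihedralLike

variable {A : Type*} {G : Type*} {ρ τ : A → G} {c₀ : A}

section MulTable

variable [AddCommGroup A] [Group G]

/-- In a dihedral-like presentation, `ρ 0 = 1`. [folklore] -/
theorem rho_zero (hρρ : ∀ a b, ρ a * ρ b = ρ (a + b)) : ρ 0 = 1 := by
  have h := hρρ 0 0
  rw [add_zero] at h
  calc ρ 0 = (ρ 0)⁻¹ * (ρ 0 * ρ 0) := by group
    _ = 1 := by rw [h, inv_mul_cancel]

/-- In a dihedral-like presentation, `(ρ a)⁻¹ = ρ (−a)`. [folklore] -/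
theorem inv_rho (hρρ : ∀ a b, ρ a * ρ b = ρ (a + b)) (a : A) : (ρ a)⁻¹ = ρ (-a) :=
  inv_eq_of_mul_eq_one_right (by rw [hρρ, add_neg_cancel, rho_zero hρρ])

/-- In a dihedral-like presentation, `(τ a)⁻¹ = τ (a − c₀)`. [folklore] -/
theorem inv_tau (hρρ : ∀ a b, ρ a * ρ b = ρ (a + b)) (hττ : ∀ a b, τ a * τ b = ρ (c₀ + b - a)) (a : A) :
    (τ a)⁻¹ = τ (a - c₀) :=
  inv_eq_of_mul_eq_one_right (by rw [hττ, ← rho_zero hρρ]; congr 1; abel)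

/-- The coset-`b` pair `(cond b (τ a') (ρ a), cond b (τ a) (ρ a'))` has right quotient the rotation `ρ (a − a')`,
for both `b`. [folklore] -/
theorem cond_mul_cond_inv' (hρρ : ∀ a b, ρ a * ρ b = ρ (a + b)) (hττ : ∀ a b, τ a * τ b = ρ (c₀ + b - a))
    (b : Bool) (a a' : A) : cond b (τ a') (ρ a) * (cond b (τ a) (ρ a'))⁻¹ = ρ (a - a') := by
  cases b
  · simp only [Bool.cond_false, inv_rho hρρ, hρρ]; congr 1; abel
  · simp only [Bool.cond_true, inv_tau hρρ hττ, hττ]; congr 1; abel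

end MulTable

section Parts

/-- Membership of the first element of the pair. [folklore] -/
theorem cond_mem_fst' {X : Finset G} {b : Bool} {a a' : A}
    (ha : cond b (τ a) (ρ a) ∈ X) (ha' : cond b (τ a') (ρ a') ∈ X) : cond b (τ a') (ρ a) ∈ X := by
  cases b
  · simpa only [Bool.cond_false] using ha
  · simpa only [Bool.cond_true] using ha'

/-- Membership of the second element of the pair. [folklore] -/
theorem cond_mem_snd' {X : Finset G} {b : Bool} {a a' : A}
    (ha : cond b (τ a) (ρ a) ∈ X) (ha' : cond b (τ a') (ρ a') ∈ X) : cond b (τ a) (ρ a') ∈ X := by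
  cases b
  · simpa only [Bool.cond_false] using ha'
  · simpa only [Bool.cond_true] using ha

/-- Equality of the two elements of the pair forces `a = a'` (`ρ`, `τ` injective). [folklore] -/
theorem eq_of_cond_eq_cond' (hρ : Function.Injective ρ) (hτ : Function.Injective τ) {b : Bool} {a a' : A}
    (h : cond b (τ a') (ρ a) = cond b (τ a) (ρ a')) : a = a' := by
  cases b
  · simp only [Bool.cond_false] at h; exact hρ h
  · simp only [Bool.cond_true] at h; exact (hτ h).symm

end Parts

section Sumsets

variable [AddCommGroup A] [DecidableEq A] [Group G] {S T U : Finset G}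

omit [DecidableEq A] in
/-- **Injectivity** of `(a,b,c) ↦ a+b+c` on coset parts `X ⊆ S_i`, `Y ⊆ T_j`, `Z ⊆ U_k` of a TPP triple (the TPP
relation with the rotation `ρ((a−a')+(b−b')+(c−c')) = 1`). [folklore] -/
theorem sum_injOn' (hρρ : ∀ a b, ρ a * ρ b = ρ (a + b)) (hττ : ∀ a b, τ a * τ b = ρ (c₀ + b - a))
    (hρ : Function.Injective ρ) (hτ : Function.Injective τ)
    (h : TripleProductProperty S T U) (i j k : Bool) {X Y Z : Finset A}
    (hX : ∀ a ∈ X, cond i (τ a) (ρ a) ∈ S) (hY : ∀ b ∈ Y, cond j (τ b) (ρ b) ∈ T)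
    (hZ : ∀ c ∈ Z, cond k (τ c) (ρ c) ∈ U) :
    Set.InjOn (fun p : A × A × A => p.1 + p.2.1 + p.2.2) ↑(X ×ˢ Y ×ˢ Z) := by
  rintro ⟨a, b, c⟩ hp ⟨a', b', c'⟩ hp' heq
  simp only [coe_product, Set.mem_prod, mem_coe] at hp hp'
  simp only at heq
  have key : cond i (τ a') (ρ a) * (cond i (τ a) (ρ a'))⁻¹ *
      (cond j (τ b') (ρ b) * (cond j (τ b) (ρ b'))⁻¹) *
      (cond k (τ c') (ρ c) * (cond k (τ c) (ρ c'))⁻¹) = 1 := by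
    rw [cond_mul_cond_inv' hρρ hττ, cond_mul_cond_inv' hρρ hττ, cond_mul_cond_inv' hρρ hττ, hρρ, hρρ,
      ← rho_zero hρρ]
    congr 1
    rw [show a - a' + (b - b') + (c - c') = a + b + c - (a' + b' + c') by abel]
    exact sub_eq_zero.mpr heq
  obtain ⟨h1, h2, h3⟩ := h _ (cond_mem_fst' (hX a hp.1) (hX a' hp'.1)) _ (cond_mem_snd' (hX a hp.1) (hX a' hp'.1))
    _ (cond_mem_fst' (hY b hp.2.1) (hY b' hp'.2.1)) _ (cond_mem_snd' (hY b hp.2.1) (hY b' hp'.2.1))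
    _ (cond_mem_fst' (hZ c hp.2.2) (hZ c' hp'.2.2)) _ (cond_mem_snd' (hZ c hp.2.2) (hZ c' hp'.2.2)) key
  have ea := eq_of_cond_eq_cond' hρ hτ h1
  have eb := eq_of_cond_eq_cond' hρ hτ h2
  have ec := eq_of_cond_eq_cond' hρ hτ h3
  subst ea eb ec
  rfl

/-- `|X + Y + Z| = |X| |Y| |Z|` for coset parts of a TPP triple. [folklore] -/
theorem card_sumset' (hρρ : ∀ a b, ρ a * ρ b = ρ (a + b)) (hττ : ∀ a b, τ a * τ b = ρ (c₀ + b - a))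
    (hρ : Function.Injective ρ) (hτ : Function.Injective τ)
    (h : TripleProductProperty S T U) (i j k : Bool) {X Y Z : Finset A}
    (hX : ∀ a ∈ X, cond i (τ a) (ρ a) ∈ S) (hY : ∀ b ∈ Y, cond j (τ b) (ρ b) ∈ T)
    (hZ : ∀ c ∈ Z, cond k (τ c) (ρ c) ∈ U) :
    ((X ×ˢ Y ×ˢ Z).image fun p : A × A × A => p.1 + p.2.1 + p.2.2).card = X.card * Y.card * Z.card := by
  rw [card_image_of_injOn (sum_injOn' hρρ hττ hρ hτ h i j k hX hY hZ), card_product, card_product, mul_assoc]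

/-- **Disjointness 1** (`S₁+T₀+U_k` vs `S₀+T₁+U_k`): the relation `τa (ρa')⁻¹ · (ρb (τb')⁻¹) · (u u'⁻¹) = 1` would
force `τ a = ρ a'`. The constant `c₀` cancels. [folklore] -/
theorem disjoint_sumset₁' (hρρ : ∀ a b, ρ a * ρ b = ρ (a + b)) (hρτ : ∀ a b, ρ a * τ b = τ (b - a))
    (hτρ : ∀ a b, τ a * ρ b = τ (a + b)) (hττ : ∀ a b, τ a * τ b = ρ (c₀ + b - a)) (hne : ∀ a b, ρ a ≠ τ b)
    (h : TripleProductProperty S T U) (k : Bool) {X Y Z X' Y' : Finset A}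
    (hX : ∀ a ∈ X, τ a ∈ S) (hY : ∀ b ∈ Y, ρ b ∈ T) (hZ : ∀ c ∈ Z, cond k (τ c) (ρ c) ∈ U)
    (hX' : ∀ a ∈ X', ρ a ∈ S) (hY' : ∀ b ∈ Y', τ b ∈ T) :
    Disjoint ((X ×ˢ Y ×ˢ Z).image fun p : A × A × A => p.1 + p.2.1 + p.2.2)
      ((X' ×ˢ Y' ×ˢ Z).image fun p : A × A × A => p.1 + p.2.1 + p.2.2) := by
  rw [disjoint_left]
  intro x hx hx'
  rw [mem_sumset₃] at hx hx'
  obtain ⟨a, ha, b, hb, c, hc, rfl⟩ := hx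
  obtain ⟨a', ha', b', hb', c', hc', heq⟩ := hx'
  have key : τ a * (ρ a')⁻¹ * (ρ b * (τ b')⁻¹) * (cond k (τ c) (ρ c') * (cond k (τ c') (ρ c))⁻¹) = 1 := by
    rw [cond_mul_cond_inv' hρρ hττ, inv_rho hρρ, inv_tau hρρ hττ, hτρ, hρτ, hττ, hρρ, ← rho_zero hρρ]
    congr 1
    rw [show c₀ + (b' - c₀ - b) - (a + -a') + (c' - c) = a' + b' + c' - (a + b + c) by abel]
    exact sub_eq_zero.mpr heq
  obtain ⟨h1, -, -⟩ := h _ (hX a ha) _ (hX' a' ha') _ (hY b hb) _ (hY' b' hb')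
    _ (cond_mem_fst' (hZ c' hc') (hZ c hc)) _ (cond_mem_snd' (hZ c' hc') (hZ c hc)) key
  exact hne _ _ h1.symm

/-- **Disjointness 2** (`S_i+T₁+U₀` vs `S_i+T₀+U₁`): the relation would force `τ b = ρ b'`. [folklore] -/
theorem disjoint_sumset₂' (hρρ : ∀ a b, ρ a * ρ b = ρ (a + b)) (hρτ : ∀ a b, ρ a * τ b = τ (b - a))
    (hτρ : ∀ a b, τ a * ρ b = τ (a + b)) (hττ : ∀ a b, τ a * τ b = ρ (c₀ + b - a)) (hne : ∀ a b, ρ a ≠ τ b)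
    (h : TripleProductProperty S T U) (i : Bool) {X Y Z X' Y' Z' : Finset A}
    (hX : ∀ a ∈ X, cond i (τ a) (ρ a) ∈ S) (hY : ∀ b ∈ Y, τ b ∈ T) (hZ : ∀ c ∈ Z, ρ c ∈ U)
    (hX' : ∀ a ∈ X', cond i (τ a) (ρ a) ∈ S) (hY' : ∀ b ∈ Y', ρ b ∈ T) (hZ' : ∀ c ∈ Z', τ c ∈ U) :
    Disjoint ((X ×ˢ Y ×ˢ Z).image fun p : A × A × A => p.1 + p.2.1 + p.2.2)
      ((X' ×ˢ Y' ×ˢ Z').image fun p : A × A × A => p.1 + p.2.1 + p.2.2) := by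
  rw [disjoint_left]
  intro x hx hx'
  rw [mem_sumset₃] at hx hx'
  obtain ⟨a, ha, b, hb, c, hc, rfl⟩ := hx
  obtain ⟨a', ha', b', hb', c', hc', heq⟩ := hx'
  have key : cond i (τ a) (ρ a') * (cond i (τ a') (ρ a))⁻¹ * (τ b * (ρ b')⁻¹) * (ρ c * (τ c')⁻¹) = 1 := by
    rw [cond_mul_cond_inv' hρρ hττ, inv_rho hρρ, inv_tau hρρ hττ, hτρ, hρτ, hρτ, hττ, ← rho_zero hρρ]
    congr 1
    rw [show c₀ + (c' - c₀ - c) - (b + -b' - (a' - a)) = a' + b' + c' - (a + b + c) by abel]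
    exact sub_eq_zero.mpr heq
  obtain ⟨-, h2, -⟩ := h _ (cond_mem_fst' (hX' a' ha') (hX a ha)) _ (cond_mem_snd' (hX' a' ha') (hX a ha))
    _ (hY b hb) _ (hY' b' hb') _ (hZ c hc) _ (hZ' c' hc') key
  exact hne _ _ h2.symm

/-- **Disjointness 3** (`S₀+T_j+U₁` vs `S₁+T_j+U₀`): the relation would force `ρ a = τ a'`. [folklore] -/
theorem disjoint_sumset₃' (hρρ : ∀ a b, ρ a * ρ b = ρ (a + b)) (hρτ : ∀ a b, ρ a * τ b = τ (b - a))
    (hτρ : ∀ a b, τ a * ρ b = τ (a + b)) (hττ : ∀ a b, τ a * τ b = ρ (c₀ + b - a)) (hne : ∀ a b, ρ a ≠ τ b)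
    (h : TripleProductProperty S T U) (j : Bool) {X Y Z X' Z' : Finset A}
    (hX : ∀ a ∈ X, ρ a ∈ S) (hY : ∀ b ∈ Y, cond j (τ b) (ρ b) ∈ T) (hZ : ∀ c ∈ Z, τ c ∈ U)
    (hX' : ∀ a ∈ X', τ a ∈ S) (hZ' : ∀ c ∈ Z', ρ c ∈ U) :
    Disjoint ((X ×ˢ Y ×ˢ Z).image fun p : A × A × A => p.1 + p.2.1 + p.2.2)
      ((X' ×ˢ Y ×ˢ Z').image fun p : A × A × A => p.1 + p.2.1 + p.2.2) := by
  rw [disjoint_left]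
  intro x hx hx'
  rw [mem_sumset₃] at hx hx'
  obtain ⟨a, ha, b, hb, c, hc, rfl⟩ := hx
  obtain ⟨a', ha', b', hb', c', hc', heq⟩ := hx'
  -- use the second box first so that no `2 c₀` appears: `τa' (ρa)⁻¹ · ρ(b'−b) · (ρc' (τc)⁻¹) = ρ(...)`
  have key : τ a' * (ρ a)⁻¹ * (cond j (τ b) (ρ b') * (cond j (τ b') (ρ b))⁻¹) * (ρ c' * (τ c)⁻¹) = 1 := by
    rw [cond_mul_cond_inv' hρρ hττ, inv_rho hρρ, inv_tau hρρ hττ, hτρ, hρτ, hτρ, hττ, ← rho_zero hρρ]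
    congr 1
    rw [show c₀ + (c - c₀ - c') - (a' + -a + (b' - b)) = a + b + c - (a' + b' + c') by abel]
    exact sub_eq_zero.mpr heq.symm
  obtain ⟨h1, -, -⟩ := h _ (hX' a' ha') _ (hX a ha) _ (cond_mem_fst' (hY b' hb') (hY b hb))
    _ (cond_mem_snd' (hY b' hb') (hY b hb)) _ (hZ' c' hc') _ (hZ c hc) key
  exact hne _ _ h1.symm

end Sumsets

section Count

variable [Fintype A] [DecidableEq G]

/-- `|X| = |{a : ρ a ∈ X}| + |{a : τ a ∈ X}|` when every element of `G` is a `ρ a` or a `τ a`. [folklore] -/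
theorem card_eq_parts' (hρ : Function.Injective ρ) (hτ : Function.Injective τ)
    (hne : ∀ a b, ρ a ≠ τ b) (hsurj : ∀ g, (∃ a, ρ a = g) ∨ (∃ a, τ a = g)) (X : Finset G) :
    X.card = (univ.filter fun a : A => ρ a ∈ X).card + (univ.filter fun a : A => τ a ∈ X).card := by
  have hX : X = (univ.filter fun a : A => ρ a ∈ X).map ⟨ρ, hρ⟩ ∪ (univ.filter fun a : A => τ a ∈ X).map ⟨τ, hτ⟩ := by
    ext g
    simp only [mem_union, mem_map, mem_filter, mem_univ, true_and, Function.Embedding.coeFn_mk]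
    constructor
    · intro hg
      rcases hsurj g with ⟨a, rfl⟩ | ⟨a, rfl⟩
      · exact Or.inl ⟨a, hg, rfl⟩
      · exact Or.inr ⟨a, hg, rfl⟩
    · rintro (⟨a, ha, rfl⟩ | ⟨a, ha, rfl⟩) <;> exact ha
  have hdisj : Disjoint ((univ.filter fun a : A => ρ a ∈ X).map ⟨ρ, hρ⟩)
      ((univ.filter fun a : A => τ a ∈ X).map ⟨τ, hτ⟩) := by
    rw [disjoint_left]
    intro g hg hg'
    simp only [mem_map, Function.Embedding.coeFn_mk] at hg hg'
    obtain ⟨a, -, rfl⟩ := hg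
    obtain ⟨b, -, hb⟩ := hg'
    exact hne a b hb.symm
  conv_lhs => rw [hX]
  rw [card_union_of_disjoint hdisj, card_map, card_map]

end Count

variable [AddCommGroup A] [DecidableEq A] [Fintype A] [Group G] [DecidableEq G] {S T U : Finset G}

/-- **`3|S||T||U| ≤ 8|A|` for every TPP triple of a group with a dihedral-like presentation** over the finite
abelian group `A` (generalized dihedral / generalized dicyclic groups; `|G| = 2|A|`). [folklore] -/
theorem tpp_volume_le_of_dihedralLike
    (hρρ : ∀ a b, ρ a * ρ b = ρ (a + b)) (hρτ : ∀ a b, ρ a * τ b = τ (b - a))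
    (hτρ : ∀ a b, τ a * ρ b = τ (a + b)) (hττ : ∀ a b, τ a * τ b = ρ (c₀ + b - a))
    (hρ : Function.Injective ρ) (hτ : Function.Injective τ) (hne : ∀ a b, ρ a ≠ τ b)
    (hsurj : ∀ g, (∃ a, ρ a = g) ∨ (∃ a, τ a = g)) (h : TripleProductProperty S T U) :
    3 * (S.card * T.card * U.card) ≤ 8 * Fintype.card A := by
  set S₀ : Finset A := univ.filter fun a => ρ a ∈ S with hS₀
  set S₁ : Finset A := univ.filter fun a => τ a ∈ S with hS₁
  set T₀ : Finset A := univ.filter fun a => ρ a ∈ T with hT₀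
  set T₁ : Finset A := univ.filter fun a => τ a ∈ T with hT₁
  set U₀ : Finset A := univ.filter fun a => ρ a ∈ U with hU₀
  set U₁ : Finset A := univ.filter fun a => τ a ∈ U with hU₁
  have mS₀ : ∀ a ∈ S₀, cond false (τ a) (ρ a) ∈ S := fun a ha => by simpa [hS₀] using ha
  have mS₁ : ∀ a ∈ S₁, cond true (τ a) (ρ a) ∈ S := fun a ha => by simpa [hS₁] using ha
  have mT₀ : ∀ a ∈ T₀, cond false (τ a) (ρ a) ∈ T := fun a ha => by simpa [hT₀] using ha
  have mT₁ : ∀ a ∈ T₁, cond true (τ a) (ρ a) ∈ T := fun a ha => by simpa [hT₁] using ha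
  have mU₀ : ∀ a ∈ U₀, cond false (τ a) (ρ a) ∈ U := fun a ha => by simpa [hU₀] using ha
  have mU₁ : ∀ a ∈ U₁, cond true (τ a) (ρ a) ∈ U := fun a ha => by simpa [hU₁] using ha
  have hn : ∀ X : Finset A, X.card ≤ Fintype.card A := fun X => card_le_univ X
  have cs := card_sumset' hρρ hττ hρ hτ h
  have d₁ := disjoint_sumset₁' hρρ hρτ hτρ hττ hne h
  have d₂ := disjoint_sumset₂' hρρ hρτ hτρ hττ hne h
  have d₃ := disjoint_sumset₃' hρρ hρτ hτρ hττ hne h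
  have h₀ : S₀.card * T₀.card * U₀.card ≤ Fintype.card A := by
    rw [← cs false false false mS₀ mT₀ mU₀]; exact hn _
  have h₃ : S₁.card * T₁.card * U₁.card ≤ Fintype.card A := by
    rw [← cs true true true mS₁ mT₁ mU₁]; exact hn _
  have h₁ : S₁.card * T₀.card * U₀.card + S₀.card * T₁.card * U₀.card + S₀.card * T₀.card * U₁.card ≤
      Fintype.card A := by
    rw [← cs true false false mS₁ mT₀ mU₀, ← cs false true false mS₀ mT₁ mU₀, ← cs false false true mS₀ mT₀ mU₁,
      ← card_union_of_disjoint (d₁ false mS₁ mT₀ mU₀ mS₀ mT₁),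
      ← card_union_of_disjoint (disjoint_union_left.2
        ⟨(d₃ false mS₀ mT₀ mU₁ mS₁ mU₀).symm, d₂ false mS₀ mT₁ mU₀ mS₀ mT₀ mU₁⟩)]
    exact hn _
  have h₂ : S₀.card * T₁.card * U₁.card + S₁.card * T₀.card * U₁.card + S₁.card * T₁.card * U₀.card ≤
      Fintype.card A := by
    rw [← cs false true true mS₀ mT₁ mU₁, ← cs true false true mS₁ mT₀ mU₁, ← cs true true false mS₁ mT₁ mU₀,
      ← card_union_of_disjoint (d₁ true mS₁ mT₀ mU₁ mS₀ mT₁).symm,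
      ← card_union_of_disjoint (disjoint_union_left.2
        ⟨d₃ true mS₀ mT₁ mU₁ mS₁ mU₀, (d₂ true mS₁ mT₁ mU₀ mS₁ mT₀ mU₁).symm⟩)]
    exact hn _
  rw [card_eq_parts' hρ hτ hne hsurj S, card_eq_parts' hρ hτ hne hsurj T, card_eq_parts' hρ hτ hne hsurj U]
  exact core_nat _ _ _ _ _ _ _ h₀ h₃ h₁ h₂

/-- The same with the group order: `3|S||T||U| ≤ 4|G|` (as `|G| = 2|A|`). [folklore] -/
theorem tpp_volume_le_of_dihedralLike_card [Fintype G]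
    (hρρ : ∀ a b, ρ a * ρ b = ρ (a + b)) (hρτ : ∀ a b, ρ a * τ b = τ (b - a))
    (hτρ : ∀ a b, τ a * ρ b = τ (a + b)) (hττ : ∀ a b, τ a * τ b = ρ (c₀ + b - a))
    (hρ : Function.Injective ρ) (hτ : Function.Injective τ) (hne : ∀ a b, ρ a ≠ τ b)
    (hsurj : ∀ g, (∃ a, ρ a = g) ∨ (∃ a, τ a = g)) (h : TripleProductProperty S T U) :
    3 * (S.card * T.card * U.card) ≤ 4 * Fintype.card G := by
  have hG : Fintype.card G = Fintype.card A + Fintype.card A := by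
    rw [← Fintype.card_sum]
    refine (Fintype.card_congr (Equiv.ofBijective (Sum.elim ρ τ) ⟨?_, ?_⟩)).symm
    · rintro (a | a) (b | b) hab
      · exact congrArg Sum.inl (hρ hab)
      · exact absurd hab (hne a b)
      · exact absurd hab.symm (hne b a)
      · exact congrArg Sum.inr (hτ hab)
    · intro g
      rcases hsurj g with ⟨a, rfl⟩ | ⟨a, rfl⟩
      exacts [⟨Sum.inl a, rfl⟩, ⟨Sum.inr a, rfl⟩]
  have := tpp_volume_le_of_dihedralLike hρρ hρτ hτρ hττ hρ hτ hne hsurj h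
  omega

end DihedralLike

/-! ## Instance: the dicyclic / generalized quaternion groups `Q_{4n}` -/

/-- **`3|S||T||U| ≤ 16 n = 4|Q_{4n}|` for every TPP triple of `QuaternionGroup n`** (dicyclic group of order `4n`,
`A = ZMod 2n`, `ρ = a`, `τ = xa`, `c₀ = n`).  In particular `β(Q_{4n}) ≤ ⌊4|G|/3⌋`, matching the census values
`β(Q₈) = 8`, `β(Dic₁₂) = 16`, `β(Q₁₆) = 16 < 21`, `β(Dic₂₀) = 24`, `β(Dic₂₄) = 32`. [folklore] -/
theorem tpp_volume_le_quaternion {n : ℕ} [NeZero n] {S T U : Finset (QuaternionGroup n)}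
    (h : TripleProductProperty S T U) : 3 * (S.card * T.card * U.card) ≤ 16 * n := by
  have key := tpp_volume_le_of_dihedralLike (A := ZMod (2 * n)) (ρ := QuaternionGroup.a) (τ := QuaternionGroup.xa)
    (c₀ := (n : ZMod (2 * n))) QuaternionGroup.a_mul_a QuaternionGroup.a_mul_xa QuaternionGroup.xa_mul_a
    QuaternionGroup.xa_mul_xa (fun i j hij => by cases hij; rfl) (fun i j hij => by cases hij; rfl)
    (fun i j hij => by cases hij) (fun g => by
      cases g with
      | a i => exact Or.inl ⟨i, rfl⟩
      | xa i => exact Or.inr ⟨i, rfl⟩) h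
  rw [ZMod.card] at key
  omega

/-- The dihedral bound re-derived from the general theorem (`A = ZMod n`, `ρ = r`, `τ = sr`, `c₀ = 0`); the direct
proof is `tpp_volume_le_dihedral`. [folklore] -/
theorem tpp_volume_le_dihedral' {n : ℕ} [NeZero n] {S T U : Finset (DihedralGroup n)}
    (h : TripleProductProperty S T U) : 3 * (S.card * T.card * U.card) ≤ 8 * n := by
  have key := tpp_volume_le_of_dihedralLike (A := ZMod n) (ρ := DihedralGroup.r) (τ := DihedralGroup.sr)
    (c₀ := (0 : ZMod n)) DihedralGroup.r_mul_r DihedralGroup.r_mul_sr DihedralGroup.sr_mul_r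
    (fun i j => by rw [DihedralGroup.sr_mul_sr, zero_add]) (fun i j hij => by cases hij; rfl)
    (fun i j hij => by cases hij; rfl) (fun i j hij => by cases hij) (fun g => by
      cases g with
      | r i => exact Or.inl ⟨i, rfl⟩
      | sr i => exact Or.inr ⟨i, rfl⟩) h
  rw [ZMod.card] at key
  omega

end Summit.MatrixMultiplication.OmegaCensus
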